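import Summits.CriticalPhenomena.Ising3DConformalLimit.Theorems.HyperoctahedralRPExistsScaleCovariantLimitFoldedCurrentIdentity
import Summits.CriticalPhenomena.Ising3DConformalLimit.Theorems.HyperoctahedralRPExistsScaleCovariantLimitFunnelDoublingIffAxisRate
import Literature.Probability.LatticeModels.CriticalAxisRatioRegularity
import Literature.Probability.LatticeModels.BoxTwoPointTransfer
import Literature.Probability.LatticeModels.CriticalTwoPointBounds
import HarnessLib

/-!
# Line `folded-current-repulsion`: the gambler's-ruin dictionary along the axis, and sublinearity of wall avoidance

Lead `prover-line-stmt-CriticalPhenomena-1981-c11-0` (crux `ExistsScaleCovariantLimit`, stmt-CriticalPhenomena-1981). Aizenman's folded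
identity (F1, `stub_foldedIdentity`, p138063) with the near source at distance `j` from the mirror plane `𝕏 = {x₀ = 0}` and the far
source `k` further along the axis gives, in the thermodynamic limit,

  `P^{−(k+j)e₀, −je₀}_{Λ_L,β_c}[−je₀ ⟷ 𝕏 folded] → g(k+2j)/g(k)`        (`tendsto_foldHitProb_dist`),

so the law of the OVERSHOOT of the critical sourced cluster beyond its near source, away from the far one, is the axis two-point
function read at the reflected points (`g(n) = ⟨σ₀σ_{ne₀}⟩_{β_c(3)}`). The limiting wall-AVOIDANCE probability from distance `j`,
`av(j;k) := 1 − g(k+2j)/g(k)`, is then SUBLINEAR in the starting distance: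

  `av(j;k) ≤ j · av(1;k)`        (`one_sub_ratio_le_mul`, from log-convexity of `g` along the axis = reflection positivity,
                                  `criticalTwoPoint_axis_ratio_mono`),

the direction gambler's ruin predicts with EQUALITY for a martingale height (`av(j;k) = j/k` for the simple random walk). The
line's engine F2 (`WallRepulsion` ⟺ item 6150, `wallRepulsion_iff_twoPointDoubling`) is the MISSING CONVERSE at `j ≍ k`:
SUPERLINEARITY `av(1;k) ≤ C·av(j;k)/j` for `j ≤ k` (then `av(1;k) ≤ C/j ≤ 2C/k`), i.e. "starting `j` times further from the wall
makes avoidance at least `j/C` times likelier" — equivalently doubling of the second differences `g(m) − g(m+2)` along the axis.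
This file records the provable half, so that the census can state the stuck goal as the one-line converse.

References: M. Aizenman, Math. Phys. Anal. Geom. 28 (2025) 32, Thm 14.2, §15; M. Aizenman, H. Duminil-Copin, Ann. Math. 194 (2021) §5.5.
-/

noncomputable section

open Filter Topology
open Literature.Probability.LatticeModels
open Summit.CriticalPhenomena.Ising3DConformalLimit.Theses
open Classical

namespace Summit.CriticalPhenomena.Ising3DConformalLimit.Cruxes.ExistsScaleCovariantLimit.FoldedCurrentRepulsion

/-! ## The dictionary `P[−je₀ ⟷ 𝕏] → g(k+2j)/g(k)` -/

/-- `θ(−je₀) = je₀`. [folklore] -/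
theorem mirror_neg_axis (j : ℕ) : mirror (Pi.single 0 (-(j : ℤ))) = Pi.single 0 (j : ℤ) := by
  funext i
  by_cases hi : i = 0
  · subst hi; rw [mirror_apply_zero]; simp
  · rw [mirror_apply_ne _ hi]; simp [Pi.single_eq_of_ne hi]

/-- `(−je₀) − (−(k+j)e₀) = k e₀`. [folklore] -/
theorem near_sub_far_dist (k j : ℕ) :
    (Pi.single 0 (-(j : ℤ)) : Site 3) - Pi.single 0 (-((k : ℤ) + j)) = Pi.single 0 (k : ℤ) := by
  rw [← Pi.single_sub]; congr 1; ring

/-- `je₀ − (−(k+j)e₀) = (k+2j) e₀`. [folklore] -/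
theorem mirror_sub_far_dist (k j : ℕ) :
    (Pi.single 0 (j : ℤ) : Site 3) - Pi.single 0 (-((k : ℤ) + j)) = Pi.single 0 ((k + 2 * j : ℕ) : ℤ) := by
  rw [← Pi.single_sub]; congr 1; push_cast; ring

/-- **The overshoot dictionary** (registered sub-goal `tendsto_foldHitProb_dist`): for `j ≥ 1`, the folded hitting probability of
the boxes at `β_c` with far source `−(k+j)e₀` and near source `−je₀` converges to `g(k+2j)/g(k)` (Aizenman 2025 Thm 14.2 in the
infinite-volume limit; `⟨·⟩^∅_{β_c} = ⟨·⟩⁺_{β_c}` on `ℤ³`). -/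
theorem tendsto_foldHitProb_dist : ∀ (k j : ℕ), 1 ≤ j →
    Tendsto (fun L : ℕ => foldHitProb L (criticalBeta 3) (Pi.single 0 (-((k : ℤ) + j))) (Pi.single 0 (-(j : ℤ)))) atTop
      (𝓝 (criticalTwoPoint 3 (Pi.single 0 ((k + 2 * j : ℕ) : ℤ)) / criticalTwoPoint 3 (Pi.single 0 (k : ℤ)))) := by
  intro k j hj
  have hβ : 0 ≤ criticalBeta 3 := criticalBeta_nonneg 3
  have hu := tendsto_isingTwoPoint_box_sub (d := 3) hβ (Pi.single 0 (-((k : ℤ) + j))) (Pi.single 0 (-(j : ℤ)))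
  have hv := tendsto_isingTwoPoint_box_sub (d := 3) hβ (Pi.single 0 (-((k : ℤ) + j))) (Pi.single 0 (j : ℤ))
  have hfree : ∀ x : Site 3, twoPointFree 3 (criticalBeta 3) x = criticalTwoPoint 3 x := fun x =>
    (twoPointPlus_criticalBeta_eq_twoPointFree_holds (d := 3) le_rfl x).symm
  rw [hfree, near_sub_far_dist] at hu
  rw [hfree, mirror_sub_far_dist] at hv
  have hgk : 0 < criticalTwoPoint 3 (Pi.single 0 (k : ℤ)) := Funnel.criticalTwoPoint_axis_pos 0 k
  have hupos : ∀ᶠ L : ℕ in atTop,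
      0 < isingTwoPoint (zdGraph 3) (box 3 L) (criticalBeta 3) 0 .free (Pi.single 0 (-((k : ℤ) + j))) (Pi.single 0 (-(j : ℤ))) :=
    hu.eventually (lt_mem_nhds hgk)
  refine (hv.div hu hgk.ne').congr' ?_
  filter_upwards [eventually_mem_box (d := 3) (Pi.single 0 (-((k : ℤ) + j))),
    eventually_mem_box (d := 3) (Pi.single 0 (-(j : ℤ))), hupos] with L ha hb hpos
  have hx0 : (Pi.single 0 (-((k : ℤ) + j)) : Site 3) 0 < 0 := by simp; omega
  have hy0 : (Pi.single 0 (-(j : ℤ)) : Site 3) 0 < 0 := by simp; omega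
  have hid := stub_foldedIdentity L (criticalBeta 3) hβ _ _ ha hb hx0 hy0
  rw [mirror_neg_axis] at hid
  show isingTwoPoint (zdGraph 3) (box 3 L) (criticalBeta 3) 0 .free (Pi.single 0 (-((k : ℤ) + j))) (Pi.single 0 (j : ℤ)) /
      isingTwoPoint (zdGraph 3) (box 3 L) (criticalBeta 3) 0 .free (Pi.single 0 (-((k : ℤ) + j))) (Pi.single 0 (-(j : ℤ))) =
    foldHitProb L (criticalBeta 3) (Pi.single 0 (-((k : ℤ) + j))) (Pi.single 0 (-(j : ℤ)))
  rw [hid]; field_simp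

/-! ## Sublinearity of the limiting avoidance probability in the starting distance -/

/-- Two-step axis ratios are nondecreasing: `g(m+2)/g(m) ≤ g(m'+2)/g(m')` for `1 ≤ m ≤ m'` (product of two consecutive one-step
ratios, each nondecreasing by log-convexity = reflection positivity, `criticalTwoPoint_axis_ratio_mono`). [folklore] -/
theorem two_step_ratio_mono {m m' : ℕ} (hm : 1 ≤ m) (hmm' : m ≤ m') :
    criticalTwoPoint 3 (Pi.single 0 ((m + 2 : ℕ) : ℤ)) / criticalTwoPoint 3 (Pi.single 0 (m : ℤ)) ≤
      criticalTwoPoint 3 (Pi.single 0 ((m' + 2 : ℕ) : ℤ)) / criticalTwoPoint 3 (Pi.single 0 (m' : ℤ)) := by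
  set g : ℕ → ℝ := fun n => criticalTwoPoint 3 (Pi.single 0 (n : ℤ)) with hg
  have hpos : ∀ n, 0 < g n := fun n => Funnel.criticalTwoPoint_axis_pos 0 n
  have hr := criticalTwoPoint_axis_ratio_mono (0 : Fin 3)
  -- one-step ratios `ρ n := g(n+1)/g(n)` are nondecreasing on `n ≥ 1`
  have hρ : ∀ {a b : ℕ}, 1 ≤ a → a ≤ b → g (a + 1) / g a ≤ g (b + 1) / g b := by
    intro a b ha hab
    obtain ⟨a', rfl⟩ : ∃ a', a = a' + 1 := ⟨a - 1, by omega⟩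
    obtain ⟨b', rfl⟩ : ∃ b', b = b' + 1 := ⟨b - 1, by omega⟩
    have := hr (show a' ≤ b' by omega)
    simpa [hg, Nat.cast_add, Nat.cast_one, add_assoc, one_add_one_eq_two] using this
  have split : ∀ n, g (n + 2) / g n = (g (n + 2) / g (n + 1)) * (g (n + 1) / g n) := fun n => by
    have h1 := (hpos (n + 1)).ne'
    field_simp
  show g (m + 2) / g m ≤ g (m' + 2) / g m'
  rw [split m, split m']
  have e1 : g (m + 2) / g (m + 1) = g (m + 1 + 1) / g (m + 1) := rfl
  have e2 : g (m' + 2) / g (m' + 1) = g (m' + 1 + 1) / g (m' + 1) := rfl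
  rw [e1, e2]
  exact mul_le_mul (hρ (by omega) (by omega)) (hρ hm hmm') (div_nonneg (hpos _).le (hpos _).le)
    (div_nonneg (hpos _).le (hpos _).le)

/-- `g(k+2j)/g(k) ≥ (g(k+2)/g(k))^j` for `k ≥ 1` (telescoping product of nondecreasing two-step ratios). [folklore] -/
theorem pow_le_ratio_dist (k j : ℕ) (hk : 1 ≤ k) :
    (criticalTwoPoint 3 (Pi.single 0 ((k + 2 : ℕ) : ℤ)) / criticalTwoPoint 3 (Pi.single 0 (k : ℤ))) ^ j ≤
      criticalTwoPoint 3 (Pi.single 0 ((k + 2 * j : ℕ) : ℤ)) / criticalTwoPoint 3 (Pi.single 0 (k : ℤ)) := by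
  set g : ℕ → ℝ := fun n => criticalTwoPoint 3 (Pi.single 0 (n : ℤ)) with hg
  have hpos : ∀ n, 0 < g n := fun n => Funnel.criticalTwoPoint_axis_pos 0 n
  show (g (k + 2) / g k) ^ j ≤ g (k + 2 * j) / g k
  induction j with
  | zero => simp [(hpos k).ne']
  | succ j ih =>
    have hstep : g (k + 2) / g k ≤ g (k + 2 * j + 2) / g (k + 2 * j) :=
      two_step_ratio_mono hk (by omega)
    have hq : 0 ≤ g (k + 2) / g k := div_nonneg (hpos _).le (hpos _).le
    calc (g (k + 2) / g k) ^ (j + 1) = (g (k + 2) / g k) ^ j * (g (k + 2) / g k) := pow_succ _ _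
      _ ≤ (g (k + 2 * j) / g k) * (g (k + 2 * j + 2) / g (k + 2 * j)) :=
          mul_le_mul ih hstep hq (div_nonneg (hpos _).le (hpos _).le)
      _ = g (k + 2 * (j + 1)) / g k := by
          have h1 := (hpos (k + 2 * j)).ne'
          rw [show k + 2 * (j + 1) = k + 2 * j + 2 by ring]
          field_simp

/-- **SUBLINEARITY OF WALL AVOIDANCE (registered sub-goal `one_sub_ratio_le_mul`).** For `k ≥ 1` and every `j`,
`1 − g(k+2j)/g(k) ≤ j · (1 − g(k+2)/g(k))`: the limiting probability that the folded critical cluster sourced at `−je₀` (far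
source `k` further) avoids the wall is at most `j` times the avoidance probability from distance `1` — Bernoulli's inequality on
`pow_le_ratio_dist`. Gambler's ruin (`av(j) = j/k` for a martingale height) says this is sharp up to constants; the converse
superlinearity at `j ≍ k` is exactly the open engine `WallRepulsion` (⟺ item 6150). -/
theorem one_sub_ratio_le_mul : ∀ (k j : ℕ), 1 ≤ k →
    1 - criticalTwoPoint 3 (Pi.single 0 ((k + 2 * j : ℕ) : ℤ)) / criticalTwoPoint 3 (Pi.single 0 (k : ℤ)) ≤
      j * (1 - criticalTwoPoint 3 (Pi.single 0 ((k + 2 : ℕ) : ℤ)) / criticalTwoPoint 3 (Pi.single 0 (k : ℤ))) := by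
  intro k j hk
  set q : ℝ := criticalTwoPoint 3 (Pi.single 0 ((k + 2 : ℕ) : ℤ)) / criticalTwoPoint 3 (Pi.single 0 (k : ℤ)) with hq
  have hq0 : 0 ≤ q := div_nonneg (Funnel.criticalTwoPoint_axis_pos 0 (k + 2)).le (Funnel.criticalTwoPoint_axis_pos 0 k).le
  have hq1 : q ≤ 1 := by
    rw [hq, div_le_one (Funnel.criticalTwoPoint_axis_pos 0 k)]
    exact Funnel.criticalTwoPoint_axis_antitone 0 (by omega)
  have hbern : 1 + (j : ℝ) * (q - 1) ≤ q ^ j := by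
    have := one_add_mul_le_pow (show (-2 : ℝ) ≤ q - 1 by linarith) j
    simpa using this
  have hpow := pow_le_ratio_dist k j hk
  rw [← hq] at hpow
  nlinarith [hbern, hpow]

end Summit.CriticalPhenomena.Ising3DConformalLimit.Cruxes.ExistsScaleCovariantLimit.FoldedCurrentRepulsion

end
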